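import Summits.QuantumFields.BalabanUV.T4Continuum.Spine.NE1p.DressedWindowScheduleModWin
import Mathlib.Analysis.PSeries

/-!
# T⁴ programme, spine estimate NE1′ (node O3b/H2) — SUMMABLE SCHEDULES: the per-step-window format's admissible data EXACTLY
# (NE1′ formalisation swarm, own-initiative supplier item S1g in the scope of rows S1d ∕ S1e of `t4/formal/NE1p/LEAVES.md`;
# INTENT CLAIMS.log l.10557; the located cost LF-3 of `DressedWindowScheduleFloors` (S1f, p214527) turned into an equivalence)

Cell `pub-balaban`, sub-cell `t4`, BINDER-OWNERS row NE1′, formalisation swarm `b2b-balaban-t4-ne1p-formalise-*`, seat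
`b2b-balaban-t4-ne1p-formalise-leaf-04` (gen 2; rows S1 p212498, S1b p212785, S1d p213367, S1e p213646 ∕ p213785 ∕ p213935 ∕
p213946 ∕ p214439).  ADDITIVE — imports this seat's `Spine/NE1p/DressedWindowScheduleModWin` (`WindowScheduleModWin`, p213785;
transitively row S1d's `WindowScheduleWin`, p213367) and `Mathlib.Analysis.PSeries` ONLY; modifies nothing; order arithmetic and
`tsum` bookkeeping over the schedules' FIELDS — no estimate, no wall binder, no `def … : Prop`.

WHY.  Every per-step-window face of the crew (END-F-win p213121, S1d, END-F-swin p213946, END-F′-mod-swin p214439, the END-ALL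
faces S3g p213964 ∕ S3h) takes ONE schedule `W` — `WindowScheduleWin r w` (gap `ρw (k+1) + wc (k+1) + σ k ≤ ρw k`) or
`WindowScheduleModWin r w` (full gap `ρw (k+1) + wc (k+1) + ϱ₁ k + σ k ≤ ρw k`) — and serves EVERY cutoff with it; the crew's
witnesses are the geometric toys (`WindowScheduleWin.geometric`, `WindowScheduleModWin.geometric`).  Leaf-07's S1f
(`DressedWindowScheduleFloors`) located the format's COST: any `wc`-guarded per-step datum at step `K` is `≤ ρw 0 ∕ K`
(necessary RATE), a cutoff-independent floor kills the format.  This file states the format's admissible data EXACTLY: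
* §1 TAILS [arith]: `tail f k := ∑' j, f (j + k)` of a summable nonnegative sequence — `tail_succ` (`tail f k = f k + tail f (k+1)`),
  `tail_zero`, `tail_nonneg`, `tail_le_tsum`, `tail_antitone`.
* §2 NECESSITY [arith]: for ANY schedule whose windows are bounded below (`ρ∞ ≤ ρw k` for all `k` — what a non-empty window at every
  step of every cutoff needs anyway, `ρ∞ = 0` for bond balls) the per-step data are SUMMABLE in the absolute step and their sum is
  paid by the birth window: `summable_data_win` ∕ `tsum_data_win_le` (`Σ_k (wc (k+1) + σ k) ≤ ρw 0 − ρ∞`), `summable_data_mod` ∕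
  `tsum_data_mod_le` (`Σ_k (wc (k+1) + ϱ₁ k + σ k) ≤ ρw 0 − ρ∞`) — `consumption_le` ∕ `consumption_le'` + `summable_of_sum_range_le`.
  Hence `summable_σ_of_win` ∕ `summable_wc_of_win` ∕ `summable_ϱ₁_of_mod` ∕ `summable_ϱc_of_mod`: EACH displayed per-step datum
  (fluctuation radii, chart ∕ slice windows, complex margins, chart radii) is summable on its own; `summable_defect_of_hdefwk`: so is
  every generation's defect sequence under END-F-win's displayed guard `hdefwk` (the (I4′) reading, leaf-07-g3's offer l.10595).
* §3 SUFFICIENCY [data + arith]: `winOfSummable` ∕ `modOfSummable` — ANY data `σ, ϱc, [ϱ₁,] wc` with the orderings of the structures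
  and `Summable (k ↦ wc (k+1) [+ ϱ₁ k] + σ k)` give a schedule with windows `ρw k := ρ∞ + tail data k`: THE (FULL) GAP HOLDS WITH
  EQUALITY (`winOfSummable_gap_eq` ∕ `modOfSummable_gapx_eq`), the birth window is `ρ∞ + Σ data` (`…_birthWindow`), every window lies in
  `[ρ∞, ρw 0]` (`…_window_bounds`), and for `0 ≤ ρ∞` the zero background lies in every window (`…_zero_mem_window`).  The data fields
  are the given ones by `rfl`.
* §4 THE EQUIVALENCE [bookkeeping]: `exists_win_iff_summable` ∕ `exists_mod_iff_summable` — over given per-step data with the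
  orderings, a schedule with windows bounded below EXISTS IFF the data are summable.  `no_win_of_harmonic`: harmonic fluctuation radii
  `σ k = σ₀ ∕ (k+1)` (which pass every `≤ R ∕ K`-type rate test of S1f §1 for `R ≥ 2σ₀`) admit NO schedule — the rate `O(ρw 0 ∕ K)` is
  necessary, SUMMABILITY is the criterion.
* §5 THE INSTANCE [decided toy]: `geometric`'s data are summable with sum `((1+2q)σ₀ + ϱ₀)∕(1−q)` (`geometric_data_tsum`) — exactly its
  birth-window constant over `ρ∞` (`DressedWindowScheduleModWin.geometric_birthWindow`): the toy saturates §2.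

PROPOSED LF-LEDGER WORDING (typer's call; recorded, not resolved here): «LF-3 (window format), exact form: ONE per-step-window
schedule serving every cutoff exists over given per-step data (fluctuation radii σ, chart∕slice windows wc, [complex margins ϱ₁,
chart radii ϱc] with the orderings) ⇔ `k ↦ wc (k+1) [+ ϱ₁ k] + σ k` is SUMMABLE in the absolute step; the birth window is then
`ρ∞ + Σ`, nothing smaller serves; `≤ ρw 0 ∕ K` (S1f) is the necessary rate.  Whether Bałaban's per-step data are summable in the
tree's one-frame `Fld d R` currency is the instantiation question ((w3)⁺ ∕ (I4′) owners, OWNER-ANSWERS §F∕§G).»  NOT an objection: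
S1d ∕ S1e ∕ S1f ∕ S2h ∕ S3g ∕ S3h STAND (c4); nothing here is a statement about Bałaban's windows ([Balaban1989LargeFieldI] p. 190,
(1.27) p. 187: printed TYPE only, not opened here).

HONEST FRAMING.  Rung (B)+1 bookkeeping on ONE finite four-torus of fixed physical size — NOT infinite volume, NOT a mass gap,
NOT OS on ℝ⁴, NOT the Clay problem, NOT summit progress.  NE1′ is NOT PRINTED and NOT PROVED; [folklore] order arithmetic and
`tsum` bookkeeping over binder shapes, 0 sorry, 0 citations used as facts, no `def … : Prop` (the three `def`s are an ℝ-valued tail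
and two schedule-valued constructors); no wall binder ((w1), (w2-act) THE NUMBER, (w5), F-6's rate) touched.  Spine PROVED 0∕9
unchanged.  HONEST DEPENDENCY: continuum YM on T⁴ ⇐ BetaPertH ∧ nine spine estimates (0/9 proved); BetaPertH ⇐ (D1) ∧ (D4) ∧
CAP+tail; G-an2-4 gates asym, D1 and NE2/3/4.
-/

noncomputable section

namespace Summit.QuantumFields.BalabanUV.T4Continuum.NE1p.DressedWindowScheduleSummable

open Finset
open scoped BigOperators
open Literature.MathematicalPhysics.QuantumFieldTheory.Balaban1983to89
open Literature.MathematicalPhysics.QuantumFieldTheory.Balaban1983to89.T4TrajectoryModulus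
open T4BlockTransport (Fld)
open Summit.QuantumFields.BalabanUV.T4Continuum.NE1p.DressedWindowScheduleWin
open Summit.QuantumFields.BalabanUV.T4Continuum.NE1p.DressedWindowScheduleModWin

/-! ## §1 Tails of a summable nonnegative sequence -/

/-- **THE TAIL** of a sequence from step `k` on [data]: `tail f k = Σ_{j ≥ k} f j` (as `∑' j, f (j + k)`; `0` by convention when not
summable). [folklore] -/
def tail (f : ℕ → ℝ) (k : ℕ) : ℝ := ∑' j, f (j + k)

/-- [arith] [folklore] The tail from `0` is the whole sum. -/
theorem tail_zero (f : ℕ → ℝ) : tail f 0 = ∑' j, f j := by simp [tail]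

/-- [arith] [folklore] The tail recursion: `tail f k = f k + tail f (k+1)` for summable `f`. -/
theorem tail_succ {f : ℕ → ℝ} (hf : Summable f) (k : ℕ) : tail f k = f k + tail f (k + 1) := by
  have hk : Summable fun j => f (j + k) := (summable_nat_add_iff k).2 hf
  have h := hk.tsum_eq_zero_add
  simp only [zero_add] at h
  unfold tail
  rw [h]
  congr 1
  exact tsum_congr fun j => congr_arg f (by omega)

/-- [arith] [folklore] Tails of a nonnegative sequence are nonnegative. -/
theorem tail_nonneg {f : ℕ → ℝ} (hf0 : ∀ n, 0 ≤ f n) (k : ℕ) : 0 ≤ tail f k :=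
  tsum_nonneg fun j => hf0 (j + k)

/-- [arith] [folklore] Tails of a summable nonnegative sequence do not increase. -/
theorem tail_succ_le {f : ℕ → ℝ} (hf : Summable f) (hf0 : ∀ n, 0 ≤ f n) (k : ℕ) : tail f (k + 1) ≤ tail f k := by
  rw [tail_succ hf k]; linarith [hf0 k]

/-- [arith] [folklore] Tails are antitone. -/
theorem tail_antitone {f : ℕ → ℝ} (hf : Summable f) (hf0 : ∀ n, 0 ≤ f n) {j k : ℕ} (h : j ≤ k) : tail f k ≤ tail f j := by
  induction k with
  | zero => rw [Nat.le_zero.mp h]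
  | succ k ih =>
    rcases Nat.lt_or_eq_of_le h with hlt | heq
    · exact (tail_succ_le hf hf0 k).trans (ih (Nat.lt_succ_iff.mp hlt))
    · rw [heq]

/-- [arith] [folklore] Every tail is at most the whole sum. -/
theorem tail_le_tsum {f : ℕ → ℝ} (hf : Summable f) (hf0 : ∀ n, 0 ≤ f n) (k : ℕ) : tail f k ≤ ∑' j, f j := by
  rw [← tail_zero]; exact tail_antitone hf hf0 (Nat.zero_le k)

/-! ## §2 Necessity: a schedule with windows bounded below has summable per-step data, paid by the birth window -/

section Necessity

variable {r w : ℝ}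

/-- **NECESSITY (per-step-window schedule)** [arith]: if every window radius is at least `ρ∞`, the per-step data
`k ↦ wc (k+1) + σ k` are SUMMABLE — the partial sums are the consumption `≤ ρw 0 − ρ∞` (`consumption_le`). [folklore] -/
theorem summable_data_win (W : WindowScheduleWin r w) {ρinf : ℝ} (hlow : ∀ k, ρinf ≤ W.ρw k) :
    Summable fun k => W.wc (k + 1) + W.σ k :=
  summable_of_sum_range_le (c := W.ρw 0 - ρinf) (fun k => by linarith [W.wc_pos (k + 1), W.hσ k])
    fun n => (W.consumption_le n).trans (by linarith [hlow n])

/-- **THE BIRTH WINDOW PAYS THE WHOLE SUM** [arith]: `Σ_k (wc (k+1) + σ k) ≤ ρw 0 − ρ∞`. [folklore] -/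
theorem tsum_data_win_le (W : WindowScheduleWin r w) {ρinf : ℝ} (hlow : ∀ k, ρinf ≤ W.ρw k) :
    ∑' k, (W.wc (k + 1) + W.σ k) ≤ W.ρw 0 - ρinf :=
  Real.tsum_le_of_sum_range_le (fun k => by linarith [W.wc_pos (k + 1), W.hσ k])
    fun n => (W.consumption_le n).trans (by linarith [hlow n])

/-- [arith] [folklore] Hence the fluctuation radii alone are summable. -/
theorem summable_σ_of_win (W : WindowScheduleWin r w) {ρinf : ℝ} (hlow : ∀ k, ρinf ≤ W.ρw k) : Summable W.σ :=
  (summable_data_win W hlow).of_nonneg_of_le (fun k => (W.hσ k).le) fun k => by linarith [W.wc_pos (k + 1)]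

/-- [arith] [folklore] Hence the chart ∕ slice windows are summable (from step `1` on, hence all). -/
theorem summable_wc_of_win (W : WindowScheduleWin r w) {ρinf : ℝ} (hlow : ∀ k, ρinf ≤ W.ρw k) : Summable W.wc := by
  have h : Summable fun k => W.wc (k + 1) :=
    (summable_data_win W hlow).of_nonneg_of_le (fun k => (W.wc_pos (k + 1)).le) fun k => by linarith [W.hσ k]
  exact (summable_nat_add_iff 1).1 h

/-- [arith] [folklore] THE (I4′) READING: under END-F-win's displayed guard `hdefwk : defect b k′ k ≤ wc k` and nonnegative
defects, EVERY generation's defect sequence along a schedule with windows bounded below is SUMMABLE in the absolute step. -/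
theorem summable_defect_of_hdefwk (W : WindowScheduleWin r w) {ρinf : ℝ} (hlow : ∀ k, ρinf ≤ W.ρw k) {ι : Type*}
    {defect : ι → ℕ → ℕ → ℝ} (hdef0 : ∀ b k' k, 0 ≤ defect b k' k) (hdefwk : ∀ b k' k, defect b k' k ≤ W.wc k)
    (b : ι) (k' : ℕ) : Summable fun k => defect b k' k :=
  (summable_wc_of_win W hlow).of_nonneg_of_le (hdef0 b k') (hdefwk b k')

/-- **NECESSITY (the assembled leaf's schedule)** [arith]: if every window radius is at least `ρ∞`, the per-step data
`k ↦ wc (k+1) + ϱ₁ k + σ k` are SUMMABLE (`consumption_le'`). [folklore] -/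
theorem summable_data_mod (W : WindowScheduleModWin r w) {ρinf : ℝ} (hlow : ∀ k, ρinf ≤ W.ρw k) :
    Summable fun k => W.wc (k + 1) + W.ϱ₁ k + W.σ k :=
  summable_of_sum_range_le (c := W.ρw 0 - ρinf)
    (fun k => by linarith [W.wc_pos (k + 1), W.hσ k, W.ϱ₁_pos' k])
    fun n => (W.consumption_le' n).trans (by linarith [hlow n])

/-- **THE BIRTH WINDOW PAYS THE WHOLE SUM (assembled leaf)** [arith]: `Σ_k (wc (k+1) + ϱ₁ k + σ k) ≤ ρw 0 − ρ∞`. [folklore] -/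
theorem tsum_data_mod_le (W : WindowScheduleModWin r w) {ρinf : ℝ} (hlow : ∀ k, ρinf ≤ W.ρw k) :
    ∑' k, (W.wc (k + 1) + W.ϱ₁ k + W.σ k) ≤ W.ρw 0 - ρinf :=
  Real.tsum_le_of_sum_range_le (fun k => by linarith [W.wc_pos (k + 1), W.hσ k, W.ϱ₁_pos' k])
    fun n => (W.consumption_le' n).trans (by linarith [hlow n])

/-- [arith] [folklore] Hence the complex margins alone are summable. -/
theorem summable_ϱ₁_of_mod (W : WindowScheduleModWin r w) {ρinf : ℝ} (hlow : ∀ k, ρinf ≤ W.ρw k) : Summable W.ϱ₁ :=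
  (summable_data_mod W hlow).of_nonneg_of_le (fun k => (W.ϱ₁_pos' k).le)
    fun k => by linarith [W.wc_pos (k + 1), W.hσ k]

/-- [arith] [folklore] Hence the chart radii alone are summable (`0 < ϱc k < ϱ₁ k`). -/
theorem summable_ϱc_of_mod (W : WindowScheduleModWin r w) {ρinf : ℝ} (hlow : ∀ k, ρinf ≤ W.ρw k) : Summable W.ϱc :=
  (summable_ϱ₁_of_mod W hlow).of_nonneg_of_le (fun k => (W.hϱc k).le) fun k => (W.hϱc₁ k).le

end Necessity

/-! ## §3 Sufficiency: any summable data with the orderings carry a schedule, the gap holding with equality -/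

section SufficiencyWin

variable {r w : ℝ} {σ ϱc wc : ℕ → ℝ} {ρinf : ℝ} (hσ : ∀ k, 0 < σ k) (hσwc : ∀ k, 2 * σ k ≤ wc k)
  (hwcw : ∀ k, wc k ≤ w) (hwc_anti : ∀ k, wc (k + 1) ≤ wc k) (hϱc : ∀ k, 0 < ϱc k)
  (hsum : Summable fun k => wc (k + 1) + σ k)

variable (r σ ϱc wc ρinf) in
/-- **THE SCHEDULE OF SUMMABLE DATA (per-step-window form)** [data]: windows `ρw k := ρ∞ + Σ_{j ≥ k} (wc (j+1) + σ j)`; the data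
fields `σ`, `ϱc`, `wc` are the given ones (by `rfl`).  A BINDER's witness; NOT asserted for Bałaban's windows. [folklore] -/
def winOfSummable : WindowScheduleWin r w where
  ρw k := ρinf + tail (fun k => wc (k + 1) + σ k) k
  σ := σ
  ϱc := ϱc
  wc := wc
  hσ := hσ
  hσwc := hσwc
  hwcw := hwcw
  hwc_anti := hwc_anti
  hϱc := hϱc
  hgap k := by have h := tail_succ hsum k; linarith

/-- **THE GAP HOLDS WITH EQUALITY** [arith]: `ρw (k+1) + wc (k+1) + σ k = ρw k` — nothing is wasted. [folklore] -/
theorem winOfSummable_gap_eq (k : ℕ) :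
    (winOfSummable r σ ϱc wc ρinf hσ hσwc hwcw hwc_anti hϱc hsum).ρw (k + 1) + wc (k + 1) + σ k =
      (winOfSummable r σ ϱc wc ρinf hσ hσwc hwcw hwc_anti hϱc hsum).ρw k := by
  show ρinf + tail (fun k => wc (k + 1) + σ k) (k + 1) + wc (k + 1) + σ k = ρinf + tail (fun k => wc (k + 1) + σ k) k
  rw [tail_succ hsum k]; ring

/-- **THE BIRTH WINDOW IS THE FINAL WINDOW PLUS THE SUM OF THE DATA** [arith]: `ρw 0 = ρ∞ + Σ_k (wc (k+1) + σ k)` — finite,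
CUTOFF-FREE, and by §2 the least possible. [folklore] -/
theorem winOfSummable_birthWindow :
    (winOfSummable r σ ϱc wc ρinf hσ hσwc hwcw hwc_anti hϱc hsum).ρw 0 = ρinf + ∑' k, (wc (k + 1) + σ k) := by
  show ρinf + tail (fun k => wc (k + 1) + σ k) 0 = _
  rw [tail_zero]

/-- [arith] [folklore] Every window lies between the final window `ρ∞` and the birth window, at EVERY step. -/
theorem winOfSummable_window_bounds (k : ℕ) :
    ρinf ≤ (winOfSummable r σ ϱc wc ρinf hσ hσwc hwcw hwc_anti hϱc hsum).ρw k ∧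
      (winOfSummable r σ ϱc wc ρinf hσ hσwc hwcw hwc_anti hϱc hsum).ρw k ≤
        (winOfSummable r σ ϱc wc ρinf hσ hσwc hwcw hwc_anti hϱc hsum).ρw 0 := by
  have h0 : ∀ n, 0 ≤ (fun k => wc (k + 1) + σ k) n := fun n => by
    have := hσ n; have := hσwc (n + 1); have := hσ (n + 1); dsimp only; linarith
  show ρinf ≤ ρinf + tail (fun k => wc (k + 1) + σ k) k ∧
    ρinf + tail (fun k => wc (k + 1) + σ k) k ≤ ρinf + tail (fun k => wc (k + 1) + σ k) 0
  exact ⟨by linarith [tail_nonneg h0 k], by linarith [tail_antitone hsum h0 (Nat.zero_le k)]⟩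

/-- [arith] [folklore] With `0 ≤ ρ∞` the zero background lies in every window — at every step, with no condition on the cutoff. -/
theorem winOfSummable_zero_mem_window {R : Type*} [NormedRing R] {d : ℕ} (hρ : 0 ≤ ρinf) (k : ℕ) :
    (0 : Fld d R) ∈ (bondBall d ((winOfSummable r σ ϱc wc ρinf hσ hσwc hwcw hwc_anti hϱc hsum).ρw k) :
      Set (Fld d R)) := by
  have h0 := hρ.trans (winOfSummable_window_bounds hσ hσwc hwcw hwc_anti hϱc hsum (r := r) (ρinf := ρinf) k).1
  intro x ν
  simpa using h0

end SufficiencyWin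

section SufficiencyMod

variable {r w : ℝ} {σ ϱc ϱ₁ wc : ℕ → ℝ} {ρinf : ℝ} (hσ : ∀ k, 0 < σ k) (hσwc : ∀ k, 2 * σ k ≤ wc k)
  (hwcw : ∀ k, wc k ≤ w) (hwc_anti : ∀ k, wc (k + 1) ≤ wc k) (hϱc : ∀ k, 0 < ϱc k) (hϱc₁ : ∀ k, ϱc k < ϱ₁ k)
  (hϱ₁r : ∀ k, ϱ₁ k ≤ r) (hϱ₁c : ∀ k, ϱ₁ (k + 1) ≤ ϱc k) (hsum : Summable fun k => wc (k + 1) + ϱ₁ k + σ k)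

variable (σ ϱc ϱ₁ wc ρinf) in
/-- **THE SCHEDULE OF SUMMABLE DATA (the assembled leaf's form)** [data]: windows `ρw k := ρ∞ + Σ_{j ≥ k} (wc (j+1) + ϱ₁ j + σ j)`;
the data fields `σ`, `ϱc`, `ϱ₁`, `wc` are the given ones (by `rfl`).  A BINDER's witness; NOT asserted for Bałaban's windows.
[folklore] -/
def modOfSummable : WindowScheduleModWin r w where
  ρw k := ρinf + tail (fun k => wc (k + 1) + ϱ₁ k + σ k) k
  σ := σ
  ϱc := ϱc
  wc := wc
  hσ := hσ
  hσwc := hσwc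
  hwcw := hwcw
  hwc_anti := hwc_anti
  hϱc := hϱc
  hgap k := by have h := tail_succ hsum k; have h1 := (hϱc k).trans (hϱc₁ k); linarith
  ϱ₁ := ϱ₁
  hϱc₁ := hϱc₁
  hϱ₁r := hϱ₁r
  hϱ₁c := hϱ₁c
  hgapx k := by have h := tail_succ hsum k; linarith

/-- **THE FULL GAP HOLDS WITH EQUALITY** [arith]: `ρw (k+1) + wc (k+1) + ϱ₁ k + σ k = ρw k`. [folklore] -/
theorem modOfSummable_gapx_eq (k : ℕ) :
    (modOfSummable σ ϱc ϱ₁ wc ρinf hσ hσwc hwcw hwc_anti hϱc hϱc₁ hϱ₁r hϱ₁c hsum).ρw (k + 1) + wc (k + 1) + ϱ₁ k + σ k =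
      (modOfSummable σ ϱc ϱ₁ wc ρinf hσ hσwc hwcw hwc_anti hϱc hϱc₁ hϱ₁r hϱ₁c hsum).ρw k := by
  show ρinf + tail (fun k => wc (k + 1) + ϱ₁ k + σ k) (k + 1) + wc (k + 1) + ϱ₁ k + σ k =
    ρinf + tail (fun k => wc (k + 1) + ϱ₁ k + σ k) k
  rw [tail_succ hsum k]; ring

/-- **THE BIRTH WINDOW OF THE ASSEMBLED LEAF'S SCHEDULE** [arith]: `ρw 0 = ρ∞ + Σ_k (wc (k+1) + ϱ₁ k + σ k)` — finite, CUTOFF-FREE,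
and by §2 the least possible. [folklore] -/
theorem modOfSummable_birthWindow :
    (modOfSummable σ ϱc ϱ₁ wc ρinf hσ hσwc hwcw hwc_anti hϱc hϱc₁ hϱ₁r hϱ₁c hsum).ρw 0 =
      ρinf + ∑' k, (wc (k + 1) + ϱ₁ k + σ k) := by
  show ρinf + tail (fun k => wc (k + 1) + ϱ₁ k + σ k) 0 = _
  rw [tail_zero]

/-- [arith] [folklore] Every window of the assembled leaf's schedule lies between `ρ∞` and the birth window, at EVERY step. -/
theorem modOfSummable_window_bounds (k : ℕ) :
    ρinf ≤ (modOfSummable σ ϱc ϱ₁ wc ρinf hσ hσwc hwcw hwc_anti hϱc hϱc₁ hϱ₁r hϱ₁c hsum).ρw k ∧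
      (modOfSummable σ ϱc ϱ₁ wc ρinf hσ hσwc hwcw hwc_anti hϱc hϱc₁ hϱ₁r hϱ₁c hsum).ρw k ≤
        (modOfSummable σ ϱc ϱ₁ wc ρinf hσ hσwc hwcw hwc_anti hϱc hϱc₁ hϱ₁r hϱ₁c hsum).ρw 0 := by
  have h0 : ∀ n, 0 ≤ (fun k => wc (k + 1) + ϱ₁ k + σ k) n := fun n => by
    have := hσ n; have := hσwc (n + 1); have := hσ (n + 1); have := (hϱc n).trans (hϱc₁ n); dsimp only; linarith
  show ρinf ≤ ρinf + tail (fun k => wc (k + 1) + ϱ₁ k + σ k) k ∧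
    ρinf + tail (fun k => wc (k + 1) + ϱ₁ k + σ k) k ≤ ρinf + tail (fun k => wc (k + 1) + ϱ₁ k + σ k) 0
  exact ⟨by linarith [tail_nonneg h0 k], by linarith [tail_antitone hsum h0 (Nat.zero_le k)]⟩

/-- [arith] [folklore] With `0 ≤ ρ∞` the zero background lies in every window of the assembled leaf's schedule. -/
theorem modOfSummable_zero_mem_window {R : Type*} [NormedRing R] {d : ℕ} (hρ : 0 ≤ ρinf) (k : ℕ) :
    (0 : Fld d R) ∈ (bondBall d
      ((modOfSummable σ ϱc ϱ₁ wc ρinf hσ hσwc hwcw hwc_anti hϱc hϱc₁ hϱ₁r hϱ₁c hsum).ρw k) : Set (Fld d R)) := by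
  have h0 := hρ.trans
    (modOfSummable_window_bounds hσ hσwc hwcw hwc_anti hϱc hϱc₁ hϱ₁r hϱ₁c hsum (ρinf := ρinf) k).1
  intro x ν
  simpa using h0

end SufficiencyMod

/-! ## §4 The equivalence, and the harmonic non-example -/

section Equivalence

variable {r w : ℝ}

/-- **LF-3 EXACT (per-step-window form)** [bookkeeping]: over given per-step data `σ, ϱc, wc` with the orderings, a schedule whose
windows are bounded below EXISTS IFF `k ↦ wc (k+1) + σ k` is SUMMABLE. [folklore] -/
theorem exists_win_iff_summable {σ ϱc wc : ℕ → ℝ} (hσ : ∀ k, 0 < σ k) (hσwc : ∀ k, 2 * σ k ≤ wc k)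
    (hwcw : ∀ k, wc k ≤ w) (hwc_anti : ∀ k, wc (k + 1) ≤ wc k) (hϱc : ∀ k, 0 < ϱc k) :
    (∃ W : WindowScheduleWin r w, W.σ = σ ∧ W.ϱc = ϱc ∧ W.wc = wc ∧ ∃ ρinf : ℝ, ∀ k, ρinf ≤ W.ρw k) ↔
      Summable fun k => wc (k + 1) + σ k := by
  constructor
  · rintro ⟨W, hWσ, -, hWwc, ρinf, hlow⟩
    subst hWσ hWwc
    exact summable_data_win W hlow
  · intro hsum
    exact ⟨winOfSummable r σ ϱc wc 0 hσ hσwc hwcw hwc_anti hϱc hsum, rfl, rfl, rfl, 0,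
      fun k => (winOfSummable_window_bounds hσ hσwc hwcw hwc_anti hϱc hsum k).1⟩

/-- **LF-3 EXACT (the assembled leaf's form)** [bookkeeping]: over given per-step data `σ, ϱc, ϱ₁, wc` with the orderings, a
schedule whose windows are bounded below EXISTS IFF `k ↦ wc (k+1) + ϱ₁ k + σ k` is SUMMABLE. [folklore] -/
theorem exists_mod_iff_summable {σ ϱc ϱ₁ wc : ℕ → ℝ} (hσ : ∀ k, 0 < σ k) (hσwc : ∀ k, 2 * σ k ≤ wc k)
    (hwcw : ∀ k, wc k ≤ w) (hwc_anti : ∀ k, wc (k + 1) ≤ wc k) (hϱc : ∀ k, 0 < ϱc k) (hϱc₁ : ∀ k, ϱc k < ϱ₁ k)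
    (hϱ₁r : ∀ k, ϱ₁ k ≤ r) (hϱ₁c : ∀ k, ϱ₁ (k + 1) ≤ ϱc k) :
    (∃ W : WindowScheduleModWin r w,
        W.σ = σ ∧ W.ϱc = ϱc ∧ W.ϱ₁ = ϱ₁ ∧ W.wc = wc ∧ ∃ ρinf : ℝ, ∀ k, ρinf ≤ W.ρw k) ↔
      Summable fun k => wc (k + 1) + ϱ₁ k + σ k := by
  constructor
  · rintro ⟨W, hWσ, -, hWϱ₁, hWwc, ρinf, hlow⟩
    subst hWσ hWϱ₁ hWwc
    exact summable_data_mod W hlow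
  · intro hsum
    exact ⟨modOfSummable σ ϱc ϱ₁ wc 0 hσ hσwc hwcw hwc_anti hϱc hϱc₁ hϱ₁r hϱ₁c hsum, rfl, rfl, rfl, rfl, 0,
      fun k => (modOfSummable_window_bounds hσ hσwc hwcw hwc_anti hϱc hϱc₁ hϱ₁r hϱ₁c hsum k).1⟩

/-- **THE RATE IS NOT THE CRITERION** [arith]: harmonic fluctuation radii `σ k = σ₀ ∕ (k+1)`, `σ₀ > 0` — which pass every
`σ K ≤ R ∕ (2K)`-type rate test of `DressedWindowScheduleFloors` §1 once `R ≥ 2σ₀` — admit NO per-step-window schedule with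
windows bounded below, whatever `ϱc`, `wc`, `ρw`: the fluctuation radii of a schedule are summable (§2), the harmonic ones are not.
[folklore] -/
theorem no_win_of_harmonic {σ₀ : ℝ} (hσ₀ : 0 < σ₀) :
    ¬ ∃ W : WindowScheduleWin r w, (∀ k, W.σ k = σ₀ / ((k : ℝ) + 1)) ∧ ∃ ρinf : ℝ, ∀ k, ρinf ≤ W.ρw k := by
  rintro ⟨W, hWσ, ρinf, hlow⟩
  have hs : Summable W.σ := summable_σ_of_win W hlow
  have hs' : Summable fun k : ℕ => σ₀ / ((k : ℝ) + 1) := hs.congr hWσ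
  have h1 : Summable fun k : ℕ => 1 / (((k + 1 : ℕ) : ℝ)) := by
    have := hs'.div_const σ₀
    refine this.congr fun k => ?_
    push_cast
    field_simp
  exact Real.not_summable_one_div_natCast ((summable_nat_add_iff 1).1 h1)

end Equivalence

/-! ## §5 The instance: the geometric witness saturates the necessity bound -/

section Instance

/-- [decided toy] [folklore] The data of `WindowScheduleModWin.geometric` read `((1+2q)σ₀ + ϱ₀)·q^k` per step. -/
theorem geometric_data_eq {r w q σ₀ ϱ₀ ρinf : ℝ} (hq0 : 0 < q) (hq1 : q < 1) (hσ₀ : 0 < σ₀) (hσ₀w : 2 * σ₀ ≤ w)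
    (hϱ₀ : 0 < ϱ₀) (hϱ₀r : ϱ₀ ≤ r) (k : ℕ) :
    (WindowScheduleModWin.geometric r w q σ₀ ϱ₀ ρinf hq0 hq1 hσ₀ hσ₀w hϱ₀ hϱ₀r).wc (k + 1) +
        (WindowScheduleModWin.geometric r w q σ₀ ϱ₀ ρinf hq0 hq1 hσ₀ hσ₀w hϱ₀ hϱ₀r).ϱ₁ k +
        (WindowScheduleModWin.geometric r w q σ₀ ϱ₀ ρinf hq0 hq1 hσ₀ hσ₀w hϱ₀ hϱ₀r).σ k =
      ((1 + 2 * q) * σ₀ + ϱ₀) * q ^ k := by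
  show 2 * σ₀ * q ^ (k + 1) + ϱ₀ * q ^ k + σ₀ * q ^ k = ((1 + 2 * q) * σ₀ + ϱ₀) * q ^ k
  rw [pow_succ]; ring

/-- [decided toy] [folklore] The geometric data are summable. -/
theorem geometric_data_summable {r w q σ₀ ϱ₀ ρinf : ℝ} (hq0 : 0 < q) (hq1 : q < 1) (hσ₀ : 0 < σ₀) (hσ₀w : 2 * σ₀ ≤ w)
    (hϱ₀ : 0 < ϱ₀) (hϱ₀r : ϱ₀ ≤ r) :
    Summable fun k =>
      (WindowScheduleModWin.geometric r w q σ₀ ϱ₀ ρinf hq0 hq1 hσ₀ hσ₀w hϱ₀ hϱ₀r).wc (k + 1) +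
        (WindowScheduleModWin.geometric r w q σ₀ ϱ₀ ρinf hq0 hq1 hσ₀ hσ₀w hϱ₀ hϱ₀r).ϱ₁ k +
        (WindowScheduleModWin.geometric r w q σ₀ ϱ₀ ρinf hq0 hq1 hσ₀ hσ₀w hϱ₀ hϱ₀r).σ k := by
  simp_rw [geometric_data_eq hq0 hq1 hσ₀ hσ₀w hϱ₀ hϱ₀r]
  exact (summable_geometric_of_lt_one hq0.le hq1).mul_left _

/-- **THE GEOMETRIC WITNESS SATURATES §2** [decided toy]: its data sum to `((1+2q)σ₀ + ϱ₀)∕(1−q)` — exactly its birth window over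
`ρ∞` (`DressedWindowScheduleModWin.geometric_birthWindow`), i.e. equality in `tsum_data_mod_le`. [folklore] -/
theorem geometric_data_tsum {r w q σ₀ ϱ₀ ρinf : ℝ} (hq0 : 0 < q) (hq1 : q < 1) (hσ₀ : 0 < σ₀) (hσ₀w : 2 * σ₀ ≤ w)
    (hϱ₀ : 0 < ϱ₀) (hϱ₀r : ϱ₀ ≤ r) :
    ∑' k, ((WindowScheduleModWin.geometric r w q σ₀ ϱ₀ ρinf hq0 hq1 hσ₀ hσ₀w hϱ₀ hϱ₀r).wc (k + 1) +
        (WindowScheduleModWin.geometric r w q σ₀ ϱ₀ ρinf hq0 hq1 hσ₀ hσ₀w hϱ₀ hϱ₀r).ϱ₁ k +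
        (WindowScheduleModWin.geometric r w q σ₀ ϱ₀ ρinf hq0 hq1 hσ₀ hσ₀w hϱ₀ hϱ₀r).σ k) =
      ((1 + 2 * q) * σ₀ + ϱ₀) / (1 - q) := by
  simp_rw [geometric_data_eq hq0 hq1 hσ₀ hσ₀w hϱ₀ hϱ₀r]
  rw [tsum_mul_left, tsum_geometric_of_lt_one hq0.le hq1, div_eq_mul_inv]

/-- [decided toy] [folklore] Hence the geometric witness's birth window is `ρ∞ +` the sum of its data: equality in §2's bound. -/
theorem geometric_birthWindow_eq_tsum {r w q σ₀ ϱ₀ ρinf : ℝ} (hq0 : 0 < q) (hq1 : q < 1) (hσ₀ : 0 < σ₀)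
    (hσ₀w : 2 * σ₀ ≤ w) (hϱ₀ : 0 < ϱ₀) (hϱ₀r : ϱ₀ ≤ r) :
    (WindowScheduleModWin.geometric r w q σ₀ ϱ₀ ρinf hq0 hq1 hσ₀ hσ₀w hϱ₀ hϱ₀r).ρw 0 =
      ρinf + ∑' k, ((WindowScheduleModWin.geometric r w q σ₀ ϱ₀ ρinf hq0 hq1 hσ₀ hσ₀w hϱ₀ hϱ₀r).wc (k + 1) +
        (WindowScheduleModWin.geometric r w q σ₀ ϱ₀ ρinf hq0 hq1 hσ₀ hσ₀w hϱ₀ hϱ₀r).ϱ₁ k +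
        (WindowScheduleModWin.geometric r w q σ₀ ϱ₀ ρinf hq0 hq1 hσ₀ hσ₀w hϱ₀ hϱ₀r).σ k) := by
  rw [geometric_data_tsum, WindowScheduleModWin.geometric_birthWindow]

end Instance

end Summit.QuantumFields.BalabanUV.T4Continuum.NE1p.DressedWindowScheduleSummable

end
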